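import Mathlib
import Summits.KontsevichZagierPeriods.KontsevichZagierPeriods.Theorems.HyperbolicBlochOffTetraSectorKernelStubSpxSplit
import Summits.KontsevichZagierPeriods.KontsevichZagierPeriods.Theorems.HyperbolicBlochOffTetraSectorKernelRedAux

/-!
# `OffTetraSectorKernel`, line `odd-hyperbolic-ladder`: cutting a lifted simplex by a half-space —
# the edge split and the bookkeeping (helpers for the stub `stub_simplexCut`)

Points `p = (p₀, p₁, p₂)` of the upper half space lift to the paraboloid vector
`Ql p = (|p|², p₀, p₁, 1) ∈ ℝ⁴`; four rows `v : Fin 4 → Fin 4 → ℝ` span the open geodesic simplex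
`Spx v = {p | 0 < p₂ ∧ ∀ a, 0 < det v · det (v with row a := Ql p)}` (all four Cramer coordinates
of `Ql p` with respect to the rows of `v` are positive). This file provides, for the stub
`stub_simplexCut` (file `…StubSimplexCut.lean`):

* `simplexCut_edgeSplit` (registered sub-goal): the landed edge split `stub_spxSplit` transported
  to an arbitrary pair of vertices `a ≠ b` — if `w = α • v a + β • v b` with `α, β > 0`, the two
  simplices `v[b := w]`, `v[a := w]` lie in `Spx v`, are disjoint, and cover it up to a null set
  (row permutations do not change `Spx`, `redAux_spx_perm`);
* `simplexCut_glue`: the set-theoretic bookkeeping that assembles partitions of the two pieces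
  into a partition of the whole;
* `simplexCut_functional_expand` (Cramer's rule along the rows) and its two sign consequences
  `simplexCut_subset_halfSpace`, `simplexCut_inter_halfSpace_eq_empty`: a linear functional that is
  non-negative (and somewhere positive) on the four rows is positive on `Spx v`; one that is
  non-positive on the rows is non-positive on `Spx v`.

References: J. L. Dupont, C.-H. Sah, *Scissors congruences II*, J. Pure Appl. Algebra 25 (1982),
§3 (cone decompositions of geodesic simplices); the statements themselves are folklore linear
algebra.
-/

noncomputable section

open Set MeasureTheory

namespace Summit.KontsevichZagierPeriods.HyperbolicBloch.OffTetraSectorKernel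

/-! ## Determinants of the two pieces -/

/-- Replacing row `b` by `α • v a + β • v b` multiplies the determinant by `β`. [folklore] -/
theorem simplexCut_det_update_right (v : Fin 4 → Fin 4 → ℝ) {a b : Fin 4} (hab : a ≠ b)
    (α β : ℝ) :
    (Matrix.of (Function.update v b (α • v a + β • v b))).det = β * (Matrix.of v).det := by
  have e : Matrix.of (Function.update v b (α • v a + β • v b)) =
      (Matrix.of v).updateRow b (α • Matrix.of v a + β • Matrix.of v b) := rfl
  rw [e, spxSplit_det_comb (Matrix.of v) hab]

/-- Replacing row `a` by `α • v a + β • v b` multiplies the determinant by `α`. [folklore] -/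
theorem simplexCut_det_update_left (v : Fin 4 → Fin 4 → ℝ) {a b : Fin 4} (hab : a ≠ b)
    (α β : ℝ) :
    (Matrix.of (Function.update v a (α • v a + β • v b))).det = α * (Matrix.of v).det := by
  have e : Matrix.of (Function.update v a (α • v a + β • v b)) =
      (Matrix.of v).updateRow a (β • Matrix.of v b + α • Matrix.of v a) := by
    rw [add_comm]; rfl
  rw [e, spxSplit_det_comb (Matrix.of v) (Ne.symm hab)]

/-! ## The edge split for an arbitrary pair of vertices -/

/-- EDGE SPLIT (registered sub-goal; the landed `stub_spxSplit` transported by a row permutation).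
If `w = α • v a + β • v b` with `a ≠ b`, `α, β > 0` and `det v ≠ 0` (the point lifted by `w` lies on
the open edge from vertex `a` to vertex `b`), then the simplices `v[b := w]` and `v[a := w]` lie in
`Spx v`, are disjoint, and exhaust `Spx v` up to a Lebesgue-null set. [folklore] -/
theorem simplexCut_edgeSplit :
    ∀ (Ql : (Fin 3 → ℝ) → Fin 4 → ℝ), (∀ p, Ql p = ![p 0 ^ 2 + p 1 ^ 2 + p 2 ^ 2, p 0, p 1, 1]) →
    ∀ (Spx : (Fin 4 → Fin 4 → ℝ) → Set (Fin 3 → ℝ)),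
      (∀ v, Spx v = {p | 0 < p 2 ∧ ∀ a, 0 < (Matrix.of v).det * ((Matrix.of v).updateRow a (Ql p)).det}) →
    ∀ (v : Fin 4 → Fin 4 → ℝ) (a b : Fin 4) (w : Fin 4 → ℝ) (α β : ℝ), a ≠ b → 0 < α → 0 < β →
      w = α • v a + β • v b → (Matrix.of v).det ≠ 0 →
      Spx (Function.update v b w) ⊆ Spx v ∧ Spx (Function.update v a w) ⊆ Spx v ∧
        Disjoint (Spx (Function.update v b w)) (Spx (Function.update v a w)) ∧
        MeasureTheory.volume (Spx v \ (Spx (Function.update v b w) ∪ Spx (Function.update v a w))) = 0 := by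
  intro Ql hQl Spx hSpx v a b w α β hab hα hβ hw hdet
  -- the row permutation bringing `b` to `0` (and `a` to `i`)
  set π : Equiv.Perm (Fin 4) := Equiv.swap 0 b with hπ
  set i : Fin 4 := π a with hi
  have hπ0 : π 0 = b := Equiv.swap_apply_left 0 b
  have hπb : π b = 0 := Equiv.swap_apply_right 0 b
  have hπi : π i = a := Equiv.swap_apply_self 0 b a
  have hi0 : i ≠ 0 := by
    intro h
    apply hab
    have e := congrArg π h
    rwa [hπi, hπ0] at e
  have hπj : ∀ j : Fin 4, j ≠ 0 → π j ≠ b := by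
    intro j hj h
    apply hj
    have e := congrArg π h
    rwa [Equiv.swap_apply_self, hπb] at e
  have hπj' : ∀ j : Fin 4, j ≠ i → π j ≠ a := by
    intro j hj h
    apply hj
    have e := congrArg π h
    rwa [Equiv.swap_apply_self] at e
  -- the row system of `stub_spxSplit`
  set v' : Fin 4 → Fin 4 → ℝ := Function.update (v ∘ π) 0 w with hv'
  have hv'0 : v' 0 = w := Function.update_self 0 w (v ∘ π)
  have hv'i : v' i = v a := by
    rw [hv', Function.update_of_ne hi0]
    show v (π i) = v a
    rw [hπi]
  have hv'j : ∀ j : Fin 4, j ≠ 0 → v' j = v (π j) := fun j hj => by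
    rw [hv', Function.update_of_ne hj]
    rfl
  have hcomb : v' 0 = α • v' i + β • v b := by rw [hv'0, hv'i, hw]
  -- the three simplices of `stub_spxSplit` are row permutations of ours
  have hE1 : Function.update v' 0 (v b) = v ∘ π := by
    rw [hv', Function.update_idem]
    have e : v b = (v ∘ π) 0 := by
      show v b = v (π 0)
      rw [hπ0]
    rw [e, Function.update_eq_self]
  have hE2 : v' = Function.update v b w ∘ π := by
    rw [hv', Function.update_comp_equiv v π b w, Equiv.symm_swap, hπb]
  set ρ : Equiv.Perm (Fin 4) := (Equiv.swap (0 : Fin 4) i).trans π with hρ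
  have hE3 : Function.update v' i (v b) = Function.update v a w ∘ ρ := by
    funext j
    show Function.update v' i (v b) j = Function.update v a w (π (Equiv.swap (0 : Fin 4) i j))
    by_cases hji : j = i
    · rw [hji, Function.update_self, Equiv.swap_apply_right, hπ0,
        Function.update_of_ne (Ne.symm hab)]
    · rw [Function.update_of_ne hji]
      by_cases hj0 : j = 0
      · rw [hj0, hv'0, Equiv.swap_apply_left, hπi, Function.update_self]
      · rw [hv'j j hj0, Equiv.swap_apply_of_ne_of_ne hj0 hji, Function.update_of_ne (hπj' j hji)]
  -- `det v' ≠ 0`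
  have hdet' : (Matrix.of v').det ≠ 0 := by
    rw [hE2]
    have e : Matrix.of (Function.update v b w ∘ π) =
        (Matrix.of (Function.update v b w)).submatrix π id := rfl
    rw [e, Matrix.det_permute, hw, simplexCut_det_update_right v hab]
    refine mul_ne_zero ?_ (mul_ne_zero hβ.ne' hdet)
    rcases Int.units_eq_one_or (Equiv.Perm.sign π) with h | h <;> simp [h]
  obtain ⟨h1, h2, h3, h4⟩ := stub_spxSplit Ql hQl Spx hSpx v' i (v b) α β hi0 hα hβ hcomb hdet'
  rw [hE1, redAux_spx_perm Ql Spx hSpx π v] at h1 h2 h4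
  rw [hE3, redAux_spx_perm Ql Spx hSpx ρ] at h2 h3 h4
  rw [hE2, redAux_spx_perm Ql Spx hSpx π] at h1 h3 h4
  exact ⟨h1, h2, h3, h4⟩

/-! ## Assembling partitions of the two pieces -/

/-- Bookkeeping: if `S A`, `S B` are disjoint subsets of `T` covering it up to a null set, then
partitions (up to null sets, by members of the family `S` satisfying `P`) of `S A ∩ H` and of
`S B ∩ H` concatenate to one of `T ∩ H`. [folklore] -/
theorem simplexCut_glue {X : Type*} [MeasurableSpace X] (μ : Measure X) {ι : Type*}
    (S : ι → Set X) (P : ι → Prop) (T H : Set X) (A B : ι)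
    (hA : S A ⊆ T) (hB : S B ⊆ T) (hAB : Disjoint (S A) (S B)) (hnull : μ (T \ (S A ∪ S B)) = 0)
    (ihA : ∃ (N : ℕ) (ws : Fin N → ι), (∀ j, P (ws j)) ∧ (∀ j, S (ws j) ⊆ S A ∩ H) ∧
      (∀ j j', j ≠ j' → S (ws j) ∩ S (ws j') = ∅) ∧ μ ((S A ∩ H) \ ⋃ j, S (ws j)) = 0)
    (ihB : ∃ (N : ℕ) (ws : Fin N → ι), (∀ j, P (ws j)) ∧ (∀ j, S (ws j) ⊆ S B ∩ H) ∧
      (∀ j j', j ≠ j' → S (ws j) ∩ S (ws j') = ∅) ∧ μ ((S B ∩ H) \ ⋃ j, S (ws j)) = 0) :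
    ∃ (N : ℕ) (ws : Fin N → ι), (∀ j, P (ws j)) ∧ (∀ j, S (ws j) ⊆ T ∩ H) ∧
      (∀ j j', j ≠ j' → S (ws j) ∩ S (ws j') = ∅) ∧ μ ((T ∩ H) \ ⋃ j, S (ws j)) = 0 := by
  obtain ⟨N₁, w₁, hP₁, hS₁, hD₁, hZ₁⟩ := ihA
  obtain ⟨N₂, w₂, hP₂, hS₂, hD₂, hZ₂⟩ := ihB
  have hA' : ∀ k, S (w₁ k) ⊆ S A := fun k => (hS₁ k).trans inter_subset_left
  have hB' : ∀ k, S (w₂ k) ⊆ S B := fun k => (hS₂ k).trans inter_subset_left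
  refine ⟨N₁ + N₂, Fin.append w₁ w₂, ?_, ?_, ?_, ?_⟩
  · intro j
    refine Fin.addCases (fun k => ?_) (fun k => ?_) j
    · rw [Fin.append_left]; exact hP₁ k
    · rw [Fin.append_right]; exact hP₂ k
  · intro j
    refine Fin.addCases (fun k => ?_) (fun k => ?_) j
    · rw [Fin.append_left]; exact (hS₁ k).trans (inter_subset_inter_left _ hA)
    · rw [Fin.append_right]; exact (hS₂ k).trans (inter_subset_inter_left _ hB)
  · intro j
    refine Fin.addCases (motive := fun j => ∀ j', j ≠ j' →
      S (Fin.append w₁ w₂ j) ∩ S (Fin.append w₁ w₂ j') = ∅) (fun k => ?_) (fun k => ?_) j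
    · intro j'
      refine Fin.addCases (motive := fun j' => Fin.castAdd N₂ k ≠ j' →
        S (Fin.append w₁ w₂ (Fin.castAdd N₂ k)) ∩ S (Fin.append w₁ w₂ j') = ∅)
        (fun k' hne => ?_) (fun k' _ => ?_) j'
      · rw [Fin.append_left, Fin.append_left]
        exact hD₁ k k' fun h => hne (by rw [h])
      · rw [Fin.append_left, Fin.append_right]
        exact Set.disjoint_iff_inter_eq_empty.mp (hAB.mono (hA' k) (hB' k'))
    · intro j'
      refine Fin.addCases (motive := fun j' => Fin.natAdd N₁ k ≠ j' →
        S (Fin.append w₁ w₂ (Fin.natAdd N₁ k)) ∩ S (Fin.append w₁ w₂ j') = ∅)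
        (fun k' _ => ?_) (fun k' hne => ?_) j'
      · rw [Fin.append_right, Fin.append_left]
        exact Set.disjoint_iff_inter_eq_empty.mp (hAB.symm.mono (hB' k) (hA' k'))
      · rw [Fin.append_right, Fin.append_right]
        exact hD₂ k k' fun h => hne (by rw [h])
  · have hcov : (T ∩ H) \ ⋃ j, S (Fin.append w₁ w₂ j) ⊆
        (T \ (S A ∪ S B)) ∪ (((S A ∩ H) \ ⋃ j, S (w₁ j)) ∪ ((S B ∩ H) \ ⋃ j, S (w₂ j))) := by
      intro p hp
      obtain ⟨⟨hpT, hpH⟩, hpU⟩ := hp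
      rw [mem_iUnion, not_exists] at hpU
      by_cases hpA : p ∈ S A
      · refine Or.inr (Or.inl ⟨⟨hpA, hpH⟩, ?_⟩)
        rw [mem_iUnion, not_exists]
        intro k hk
        exact hpU (Fin.castAdd N₂ k) (by rwa [Fin.append_left])
      · by_cases hpB : p ∈ S B
        · refine Or.inr (Or.inr ⟨⟨hpB, hpH⟩, ?_⟩)
          rw [mem_iUnion, not_exists]
          intro k hk
          exact hpU (Fin.natAdd N₁ k) (by rwa [Fin.append_right])
        · exact Or.inl ⟨hpT, fun h => h.elim hpA hpB⟩
    exact measure_mono_null hcov (measure_union_null hnull (measure_union_null hZ₁ hZ₂))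

/-! ## Cramer's rule along the rows and the sign of a linear functional on `Spx v` -/

/-- Cramer's rule along the rows: `det V • Q = ∑ a, det (V with row a := Q) • V a`. [folklore] -/
theorem simplexCut_cramer_rows (V : Matrix (Fin 4) (Fin 4) ℝ) (Q : Fin 4 → ℝ) :
    V.det • Q = ∑ a, (V.updateRow a Q).det • V a := by
  have h := Matrix.mulVec_cramer V.transpose Q
  rw [Matrix.det_transpose, Matrix.mulVec_transpose, Matrix.vecMul_eq_sum] at h
  rw [← h]
  refine Finset.sum_congr rfl fun a _ => ?_
  rw [Matrix.cramer_transpose_apply]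

/-- A linear functional `m` evaluated through Cramer's rule:
`(det V)² (m ⬝ Q) = ∑ a, (det V · det (V with row a := Q)) (m ⬝ V a)`. [folklore] -/
theorem simplexCut_functional_expand (V : Matrix (Fin 4) (Fin 4) ℝ) (Q m : Fin 4 → ℝ) :
    V.det ^ 2 * ∑ c, m c * Q c = ∑ a, (V.det * (V.updateRow a Q).det) * ∑ c, m c * V a c := by
  have h := simplexCut_cramer_rows V Q
  have hc : ∀ c, V.det * Q c = ∑ a, (V.updateRow a Q).det * V a c := by
    intro c
    have e := congrFun h c
    simpa only [Finset.sum_apply, Pi.smul_apply, smul_eq_mul] using e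
  have hc' : ∀ c, V.det ^ 2 * (m c * Q c) = ∑ a, (V.det * (V.updateRow a Q).det) * (m c * V a c) := by
    intro c
    rw [show V.det ^ 2 * (m c * Q c) = V.det * m c * (V.det * Q c) by ring, hc c, Finset.mul_sum]
    exact Finset.sum_congr rfl fun a _ => by ring
  rw [Finset.mul_sum]
  simp_rw [hc']
  rw [Finset.sum_comm]
  exact Finset.sum_congr rfl fun a _ => by rw [Finset.mul_sum]

/-- A linear functional that is non-negative on the four rows and positive on one of them is
positive on the open simplex `Spx v` (all Cramer coordinates are positive there). [folklore] -/
theorem simplexCut_subset_halfSpace (Ql : (Fin 3 → ℝ) → Fin 4 → ℝ)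
    (Spx : (Fin 4 → Fin 4 → ℝ) → Set (Fin 3 → ℝ))
    (hSpx : ∀ v, Spx v = {p | 0 < p 2 ∧ ∀ a, 0 < (Matrix.of v).det * ((Matrix.of v).updateRow a (Ql p)).det})
    (v : Fin 4 → Fin 4 → ℝ) (m : Fin 4 → ℝ) (hnn : ∀ a, 0 ≤ ∑ c, m c * v a c) (a₀ : Fin 4)
    (ha₀ : 0 < ∑ c, m c * v a₀ c) : Spx v ⊆ {p | 0 < ∑ c, m c * Ql p c} := by
  intro p hp
  rw [hSpx] at hp
  obtain ⟨-, hp⟩ := hp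
  have key := simplexCut_functional_expand (Matrix.of v) (Ql p) m
  have hsum : 0 < ∑ a, ((Matrix.of v).det * ((Matrix.of v).updateRow a (Ql p)).det) *
      ∑ c, m c * (Matrix.of v) a c :=
    Finset.sum_pos' (fun a _ => mul_nonneg (hp a).le (hnn a)) ⟨a₀, Finset.mem_univ _, mul_pos (hp a₀) ha₀⟩
  rw [← key] at hsum
  exact pos_of_mul_pos_right hsum (sq_nonneg _)

/-- A linear functional that is non-positive on the four rows is non-positive on `Spx v`.
[folklore] -/
theorem simplexCut_inter_halfSpace_eq_empty (Ql : (Fin 3 → ℝ) → Fin 4 → ℝ)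
    (Spx : (Fin 4 → Fin 4 → ℝ) → Set (Fin 3 → ℝ))
    (hSpx : ∀ v, Spx v = {p | 0 < p 2 ∧ ∀ a, 0 < (Matrix.of v).det * ((Matrix.of v).updateRow a (Ql p)).det})
    (v : Fin 4 → Fin 4 → ℝ) (m : Fin 4 → ℝ) (hnp : ∀ a, ∑ c, m c * v a c ≤ 0) :
    Spx v ∩ {p | 0 < ∑ c, m c * Ql p c} = ∅ := by
  ext p
  simp only [mem_inter_iff, mem_setOf_eq, mem_empty_iff_false, iff_false, not_and, not_lt]
  intro hp
  rw [hSpx] at hp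
  obtain ⟨-, hp⟩ := hp
  have key := simplexCut_functional_expand (Matrix.of v) (Ql p) m
  have hsum : ∑ a, ((Matrix.of v).det * ((Matrix.of v).updateRow a (Ql p)).det) *
      ∑ c, m c * (Matrix.of v) a c ≤ 0 :=
    Finset.sum_nonpos fun a _ => mul_nonpos_of_nonneg_of_nonpos (hp a).le (hnp a)
  rw [← key] at hsum
  have hdet : 0 < (Matrix.of v).det ^ 2 := by
    rcases (sq_nonneg ((Matrix.of v).det)).lt_or_eq with h | h
    · exact h
    · exfalso
      have h0 : (Matrix.of v).det = 0 := by
        have := h.symm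
        exact pow_eq_zero_iff two_ne_zero |>.mp this
      have := hp 0
      rw [h0, zero_mul] at this
      exact lt_irrefl 0 this
  exact not_lt.mp fun h => absurd hsum (not_le.mpr (mul_pos hdet h))

end Summit.KontsevichZagierPeriods.HyperbolicBloch.OffTetraSectorKernel

end
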